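import Literature.AlgebraicGeometry.Morphisms.IsoModuloNilpotent
import Literature.AlgebraicGeometry.Morphisms.UnramifiedModuloNilpotent
import HarnessLib

/-!
# Morphisms of schemes over a nilpotent thickening: the base-change form

Topic `Literature/AlgebraicGeometry/Morphisms`; theorems only (no definition, no named fact, no
instance). Consumer-facing form of the tree's «modulo a nilpotent thickening of the base» family
(`FlatModuloNilpotent`, `IsoModuloNilpotent`, `UnramifiedModuloNilpotent`): the user hands in the
two base-change squares of the SOURCE and of the TARGET along the thickening `g : S₀ ⟶ S` of
affine schemes,
```
P₀ --iP--> P          Q₀ --iQ--> Q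
|p₀        |f ≫ q      |q₀        |q
v          v           v          v
S₀ --g---> S          S₀ --g---> S
```
(`hP : IsPullback iP p₀ (f ≫ q) g`, `hQ : IsPullback iQ q₀ q g`) together with the induced map
`f₀ : P₀ ⟶ Q₀` (`iP ≫ f = f₀ ≫ iQ`, `f₀ ≫ q₀ = p₀`); the square `(iP, f₀, f, iQ)` is then cartesian
(two-out-of-three for pullback squares, Mathlib `IsPullback.of_bot`), and:

* `flat_of_baseChange_flat` — `Γ(g)` surjective with finitely generated nilpotent kernel,
  `P` flat over `S`, `f₀` flat ⇒ `f` flat ([Matsumura1987] Thm. 22.3 (α));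
* `isIso_of_baseChange_isIso` — `Γ(g)` surjective with nilpotent kernel, `P` flat over `S`,
  `f₀` an isomorphism ⇒ `f` an isomorphism ([Schlessinger1968] Lemma 3.3); this is the shape of the
  «shear map» step for first-order deformations of group schemes (`P = Q = X ×_S X`,
  `f = (pr₁, m)`);
* `formallyUnramified_of_baseChange`, `etale_of_baseChange_etale` ([GortzWedhorn2023] Prop. 18.29).

## References
* [Matsumura1987] H. Matsumura, *Commutative Ring Theory*, §22 Thm. 22.3 (α).
* [Schlessinger1968] M. Schlessinger, *Functors of Artin rings*, Lemma 3.3, p. 216.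
* [GortzWedhorn2023] U. Görtz, T. Wedhorn, *Algebraic Geometry II*, Prop. 18.29, Def. 18.34.
-/

noncomputable section

open CategoryTheory CategoryTheory.Limits AlgebraicGeometry

universe u

namespace Literature.AlgebraicGeometry.Morphisms

variable {S S₀ P Q P₀ Q₀ : Scheme.{u}} [IsAffine S] [IsAffine S₀] {g : S₀ ⟶ S}
  {f : P ⟶ Q} {q : Q ⟶ S} {iQ : Q₀ ⟶ Q} {q₀ : Q₀ ⟶ S₀} {f₀ : P₀ ⟶ Q₀} {iP : P₀ ⟶ P}
  {p₀ : P₀ ⟶ S₀}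

omit [IsAffine S] [IsAffine S₀] in
/-- Two-out-of-three: if `P₀` and `Q₀` are the base changes of `P` and `Q` along `g` and `f₀` is
the induced map, the square `(iP, f₀, f, iQ)` is cartesian. [folklore] -/
private theorem isPullback_of_baseChange (hQ : IsPullback iQ q₀ q g)
    (hP : IsPullback iP p₀ (f ≫ q) g) (hf : iP ≫ f = f₀ ≫ iQ) (hp : f₀ ≫ q₀ = p₀) :
    IsPullback iP f₀ f iQ := by
  subst hp
  exact IsPullback.of_bot hP hf hQ

/-- **Flatness from the base change along a nilpotent thickening** (base-change form of
`flat_of_flat_of_isPullback_of_surjective_appTop`). [cite: Matsumura1987, §22 Thm. 22.3 (α),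
(3) ⇒ (1)] -/
theorem flat_of_baseChange_flat (hg : Function.Surjective g.appTop.hom)
    (hnil : IsNilpotent (RingHom.ker g.appTop.hom)) (hfg : (RingHom.ker g.appTop.hom).FG)
    (hQ : IsPullback iQ q₀ q g) (hP : IsPullback iP p₀ (f ≫ q) g) (hf : iP ≫ f = f₀ ≫ iQ)
    (hp : f₀ ≫ q₀ = p₀) [Flat (f ≫ q)] [Flat f₀] : Flat f :=
  flat_of_flat_of_isPullback_of_surjective_appTop hg hnil hfg hQ
    (isPullback_of_baseChange hQ hP hf hp)

/-- **Isomorphy from the base change along a nilpotent thickening** (base-change form of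
`isIso_of_isIso_of_isPullback_of_surjective_appTop`; e.g. the shear map `(pr₁, m)` of a
first-order deformation of a group scheme). [cite: Schlessinger1968, Lemma 3.3, p. 216] -/
theorem isIso_of_baseChange_isIso (hg : Function.Surjective g.appTop.hom)
    (hnil : IsNilpotent (RingHom.ker g.appTop.hom)) (hQ : IsPullback iQ q₀ q g)
    (hP : IsPullback iP p₀ (f ≫ q) g) (hf : iP ≫ f = f₀ ≫ iQ) (hp : f₀ ≫ q₀ = p₀)
    [Flat (f ≫ q)] [IsIso f₀] : IsIso f :=
  isIso_of_isIso_of_isPullback_of_surjective_appTop hg hnil hQ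
    (isPullback_of_baseChange hQ hP hf hp)

/-- **Formal unramifiedness from the base change along a nilpotent thickening** (base-change
form of `formallyUnramified_of_isPullback_of_surjective_appTop`). [cite: GortzWedhorn2023,
Prop. 18.6 and Prop. 18.29] -/
theorem formallyUnramified_of_baseChange (hg : Function.Surjective g.appTop.hom)
    (hnil : IsNilpotent (RingHom.ker g.appTop.hom)) (hQ : IsPullback iQ q₀ q g)
    (hP : IsPullback iP p₀ (f ≫ q) g) (hf : iP ≫ f = f₀ ≫ iQ) (hp : f₀ ≫ q₀ = p₀)
    [FormallyUnramified f₀] : FormallyUnramified f :=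
  formallyUnramified_of_isPullback_of_surjective_appTop hg hnil hQ
    (isPullback_of_baseChange hQ hP hf hp)

/-- **Étaleness from the base change along a nilpotent thickening** (base-change form of
`etale_of_isPullback_of_surjective_appTop`). [cite: GortzWedhorn2023, Def. 18.34 and
Prop. 18.29] [cite: Matsumura1987, §22 Thm. 22.3 (α), (3) ⇒ (1)] -/
theorem etale_of_baseChange_etale (hg : Function.Surjective g.appTop.hom)
    (hnil : IsNilpotent (RingHom.ker g.appTop.hom)) (hfg : (RingHom.ker g.appTop.hom).FG)
    (hQ : IsPullback iQ q₀ q g) (hP : IsPullback iP p₀ (f ≫ q) g) (hf : iP ≫ f = f₀ ≫ iQ)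
    (hp : f₀ ≫ q₀ = p₀) [Flat (f ≫ q)] [LocallyOfFinitePresentation f] [Etale f₀] : Etale f :=
  etale_of_isPullback_of_surjective_appTop hg hnil hfg hQ (isPullback_of_baseChange hQ hP hf hp)

/-! ## `Spec k ⟶ Spec k[ε]` -/

section DualNumber

variable {k : Type u} [CommRing k] {q' : Q ⟶ Spec (.of (DualNumber k))}
  {q₀' : Q₀ ⟶ Spec (.of k)} {p₀' : P₀ ⟶ Spec (.of k)}

/-- **First-order deformations, base-change form**: over `k[ε]`, with `P` flat, a morphism whose
base change to `k` is an isomorphism is an isomorphism. [cite: Schlessinger1968, Lemma 3.3,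
p. 216] -/
theorem isIso_of_baseChange_isIso_dualNumber
    (hQ : IsPullback iQ q₀' q'
      (Spec.map (CommRingCat.ofHom (TrivSqZeroExt.fstHom k k k).toRingHom)))
    (hP : IsPullback iP p₀' (f ≫ q')
      (Spec.map (CommRingCat.ofHom (TrivSqZeroExt.fstHom k k k).toRingHom)))
    (hf : iP ≫ f = f₀ ≫ iQ) (hp : f₀ ≫ q₀' = p₀') [Flat (f ≫ q')] [IsIso f₀] : IsIso f := by
  subst hp
  exact isIso_of_isIso_of_isPullback_specMap_dualNumber_fst hQ (IsPullback.of_bot hP hf hQ)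

/-- **First-order deformations, base-change form**: over `k[ε]`, with `P` flat, a morphism whose
base change to `k` is flat is flat. [cite: Matsumura1987, §22 Thm. 22.3 (α), (3) ⇒ (1)] -/
theorem flat_of_baseChange_flat_dualNumber
    (hQ : IsPullback iQ q₀' q'
      (Spec.map (CommRingCat.ofHom (TrivSqZeroExt.fstHom k k k).toRingHom)))
    (hP : IsPullback iP p₀' (f ≫ q')
      (Spec.map (CommRingCat.ofHom (TrivSqZeroExt.fstHom k k k).toRingHom)))
    (hf : iP ≫ f = f₀ ≫ iQ) (hp : f₀ ≫ q₀' = p₀') [Flat (f ≫ q')] [Flat f₀] : Flat f := by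
  subst hp
  exact flat_of_flat_of_isPullback_specMap_dualNumber_fst hQ (IsPullback.of_bot hP hf hQ)

/-- **First-order deformations, base-change form**: over `k[ε]`, with `P` flat and `f` locally
of finite presentation, a morphism whose base change to `k` is étale is étale.
[cite: GortzWedhorn2023, Def. 18.34 and Prop. 18.29] -/
theorem etale_of_baseChange_etale_dualNumber
    (hQ : IsPullback iQ q₀' q'
      (Spec.map (CommRingCat.ofHom (TrivSqZeroExt.fstHom k k k).toRingHom)))
    (hP : IsPullback iP p₀' (f ≫ q')
      (Spec.map (CommRingCat.ofHom (TrivSqZeroExt.fstHom k k k).toRingHom)))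
    (hf : iP ≫ f = f₀ ≫ iQ) (hp : f₀ ≫ q₀' = p₀') [Flat (f ≫ q')]
    [LocallyOfFinitePresentation f] [Etale f₀] : Etale f := by
  subst hp
  exact etale_of_isPullback_specMap_dualNumber_fst hQ (IsPullback.of_bot hP hf hQ)

end DualNumber

end Literature.AlgebraicGeometry.Morphisms
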